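import Summits.QuantumFields.YangMills.Theorems.BalabanUVNodesN09RegularityTowerOfLocalRouteOfHU
import Summits.QuantumFields.YangMills.Theorems.BalabanUVNodesN09HierarchyBindersOfDomainThreshold
import HarnessLib

/-!
# BalabanUVNodes ∕ N09 — ROAD B's RECORD DOOR IN THE OBJECT-SLOT CURRENCY: the hierarchical [B11] binder `hres` read off N07's Theorem-1 slot at OBJECTS `hT1` + the ₈a rows `hUk`
# and the DOMAIN threshold (dag-n09-w1 g7's `hres_of_thm1Objects_of_ukRows_of_domainThreshold`) — at ONE radius

Cell `pub-ymgap`, width seat `pub-ymgap-dag-n09-w2` generation 5 (HUMAN RULING D-0149; DAG node N09 = [Balaban1987RG1] §§2–5; INBOX CLAIM-7∕INTENT-11; dag-n09-w1 g7's consumer note I.39802∕I.397xx).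
`--kind proof --supports stmt-QuantumFields-27364 --as helper` (K1⁹ `StabilityBRunRowsAtRecordR13SepCoPHV`; count-neutral; theorems only, 0 def ∕ 0 instance ∕ 0 notation ∕ 0 sorry).

WHY.  After `…N09RegularityTowerOfLocalRouteOfHU` (p646389) road B's record door displays (181)ˢᵒˡ `hcov`, (H-U) `hU`, the on-domain hcrit, the level-wise `h11` and ONE hierarchical
[B11] binder `hres : ∀ k ≤ K, HRestrict εbg K k domAlt_k`.  dag-n09-w1 g7 (`…N09HierarchyBindersOfDomainThreshold`, p64xxxx) proved `hres` from N07's LEVEL-WISE object slots — the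
Theorem-1 slot AT OBJECTS `hT1` and the ₈a rows `hUk` (dag-n21-c p454585's currency) — plus the level-wise existence `hsol` and letters in `(ν.ε₀, εbg; a₀, a₁, B₃)` only, a road that
FIRES AT ONE RADIUS.  This file plugs it in: at `εreg = εbg`, `hsol` is `h11`'s existence half, so road B's record door reads [B11] EXACTLY as road A′'s re-keyed doors do —
level-wise `h11` + `hT1` + `hUk` — next to `hcov`, `hU`, hcrit and numerics.

WHAT IS PROVED (theorems only).
★★★ `thm3Member_stage13SepCoPH_atDomAlt_of_localRoute_of_hU_of_thm1Objects_of_εreg_eq_alphaFree` — p646389's door with `hres := hres_of_thm1Objects_of_ukRows_of_domainThreshold θ.ν θ.εbg a₀ a₁ B₃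
P.K hT1 hUk (fun k hk V hV => (h11 k hk V hV).1) hB₃ hε₀' hε₀a hq3 hq2 hqa hB hhi`.  Displayed N09-side: (181)ˢᵒˡ `hcov`, (H-U) `hU`, on-domain hcrit, level-wise `h11`, N07's object slots
`hT1`∕`hUk`; numerics in `(εreg = εbg, ε₂₉, ε₀; a₀, a₁, B₃; d, L, N)`: [B7] on `εreg`, rider `hn1 hn2`, three `ε₀`-lines, strict (hord), `((dL)²∕4)·ε₀ < δ_Fed`, `1 ≤ B₃`, `0 < ε₀ ≤ a₁`,
(53) at `B₃ε₀`, `2B₃ε₀ ≤ a₁`, `2B₃²ε₀ ≤ εbg ≤ a₀`.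

HONEST FRAMING.  Count-neutral re-keying BY NAME (one displayed hypothesis traded for a sibling's theorem and its displayed inputs); NOTHING of Bałaban's asserted; [B11] Thm 1 enters only
as displayed hypotheses (`h11`, N07's object slots `hT1`∕`hUk` — levels `k ≥ 1` proved nowhere in the tree); (H-U) displayed; on-domain hcrit has NO supplier for the bare background; N09 NOT
discharged; conjunct 1 (Lemma 4) ∕ FLAG №7 untouched; K0⁷ ∕ K1⁹ ∕ K2⁹ ∕ K3⁸ NOT closed; counts unmoved (typed 28∕28 · discharged 5∕28); no summit statement is proved here; R4 = the
conditional finite-𝕋⁴ rung `BalabanLadder.UV` only — NOT continuum ∕ ℝ⁴ ∕ OS; the Yang–Mills mass gap (Clay) is NOT proved by any of this.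
-/

noncomputable section

open Filter Topology Set Function MeasureTheory

namespace Summit.QuantumFields.YangMills.BalabanUVNodes.N09RecordDoorOfLocalRouteOfThm1Objects

open Literature.MathematicalPhysics.QuantumFieldTheory.Balaban1983to89
open Literature.MathematicalPhysics.QuantumFieldTheory.Balaban1983to89.Node00
open Literature.MathematicalPhysics.QuantumFieldTheory.Balaban1983to89.T4Continuum (T4Family)
open Literature.MathematicalPhysics.QuantumFieldTheory.Balaban1983to89.DagBinding (WorldP leavesP)
open Literature.MathematicalPhysics.QuantumFieldTheory.Balaban1983to89.B12RTGaugeInvariance254 (liftTransf)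
open Literature.MathematicalPhysics.QuantumFieldTheory.Balaban1983to89.GaugeField (gaugeAct)
open Literature.MathematicalPhysics.QuantumFieldTheory.Balaban1983to89.ExpMeanLog (expMeanLogSU deltaSU)
open Literature.MathematicalPhysics.QuantumFieldTheory.Balaban1983to89.FederbushMean (deltaFed)
open Literature.MathematicalPhysics.QuantumFieldTheory.Balaban1983to89.B12GaugeOrbits021 (OrbitRel)
open Summit.QuantumFields.YangMills.BalabanUVNodes.N09RegularityTowerOfLocalRouteOfHU (thm3Member_stage13SepCoPH_atDomAlt_of_localRoute_of_hU_of_numerics_of_εreg_eq_alphaFree)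
open Summit.QuantumFields.YangMills.BalabanUVNodes.N09HierarchyBindersOfDomainThreshold (hres_of_thm1Objects_of_ukRows_of_domainThreshold)

variable {F : T4Family} {N : ℕ} [NeZero N]

section Door

variable (θ : Stage13HParams F N) (h : θ.Provisos₁₃SepCoPH F N) {w : WorldP} (P : B12.RunParams) (a₀ a₁ B₃ : ℝ)

/-- **★★★ N09's THEOREM-3 MEMBER AT THE STAGE-13 RECORD ON THE LOCAL ROUTE — α-FREE, `huniq`-FREE, (H-U) AS ONE LETTER, `hsolν` AND `hres` READ OFF THE LEVEL-WISE `h11` + N07's OBJECT SLOTS**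
(p646389's `thm3Member_stage13SepCoPH_atDomAlt_of_localRoute_of_hU_of_numerics_of_εreg_eq_alphaFree` with `hres := hres_of_thm1Objects_of_ukRows_of_domainThreshold …` of dag-n09-w1 g7, `hsol`
there `:= (h11 …).1`).  Displayed N09-side inputs: (181)ˢᵒˡ `hcov`, (H-U) `hU`, the critical configurations CONTINUOUS ON the next domains (hcrit), the level-wise `h11`, N07's Theorem-1 slot
AT OBJECTS `hT1` and ₈a rows `hUk`; numerics as in the header.  CONDITIONAL; nothing of Bałaban's asserted; N09 NOT discharged.
[cite: Balaban1987RG1, Thm 3 p.264, p.259, (0.11) p.253, (0.17)–(0.19) p.255, (2.9) p.266, (2.10) p.267; Balaban1985Variational, Thm 1 (8)–(10) p.279 and (181) p.307; Balaban1985Averaging, Prop. 2 (53) p.26] -/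
theorem thm3Member_stage13SepCoPH_atDomAlt_of_localRoute_of_hU_of_thm1Objects_of_εreg_eq_alphaFree
    (hC : w.C = (datumOfRecord₁₃SepCoPH F N θ h).C) (hε : 0 < θ.ε₂₉) (heq : θ.toStage13Params.ν.εreg = θ.εbg)
    (hεreg : 0 < θ.toStage13Params.ν.εreg)
    (hε3 : (143 * (((((F.P P.K).d + 4 : ℕ) : ℝ)) ^ 2 / 4) ^ 2) * θ.toStage13Params.ν.εreg ≤ 1 / 3)
    (hε2 : 2 * θ.toStage13Params.ν.εreg ≤ 2 * deltaSU (Fin N) / ((((F.P P.K).d + 4) * (F.P P.K).L : ℕ) : ℝ) ^ 2)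
    (hn1 : 1640 * (2 * (((((F.P P.K).d + 2) * (F.P P.K).L : ℕ) : ℝ) * θ.toStage13Params.ε₂₉) +
        ((((F.P P.K).d + 2) * (F.P P.K).L : ℕ) : ℝ) ^ 2 / 4 * (2 * θ.toStage13Params.ν.εreg / ((F.P P.K).L : ℝ) ^ 2)) *
          (((F.P P.K).L : ℝ) ^ ((F.P P.K).d - 1)) ^ 2 ≤ 1)
    (hn2 : 13 * (2 * (((((F.P P.K).d + 2) * (F.P P.K).L : ℕ) : ℝ) * θ.toStage13Params.ε₂₉) +
        ((((F.P P.K).d + 2) * (F.P P.K).L : ℕ) : ℝ) ^ 2 / 4 * (2 * θ.toStage13Params.ν.εreg / ((F.P P.K).L : ℝ) ^ 2)) *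
          ((F.P P.K).L : ℝ) ^ ((F.P P.K).d - 1) < deltaSU (Fin N))
    (hcov : ∀ j < P.K, ∀ (v : GaugeTransf (F.P P.K) (j + 1) (SU N)) (W : GaugeField (F.P P.K) (j + 1) (SU N)),
      UkExists F N P.K (j + 1) θ.toStage13Params.ν.εreg W →
        critCfgOfRecord F N θ.toStage13Params.ν P.K j (gaugeAct v W) = gaugeAct (liftTransf v) (critCfgOfRecord F N θ.toStage13Params.ν P.K j W))
    (hU : ∀ k, Measurable (Uk F N P.K (k + 1) θ.toStage13Params.ν.εreg))
    (hcrit : ∀ j < P.K, ContinuousOn (critCfgOfRecord F N θ.toStage13Params.ν P.K j) (domAltOfRecord F N θ.ν P.K (j + 1)))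
    (h24 : ((((F.P P.K).d + 2) * (F.P P.K).L : ℕ) : ℝ) ^ 2 / 4 * θ.toStage13Params.ν.ε₀ < 1 / 24)
    (h64 : 64 * (((((F.P P.K).d + 2) * (F.P P.K).L : ℕ) : ℝ) ^ 2 / 4 * θ.toStage13Params.ν.ε₀) < deltaSU (Fin N))
    (hL : 157 * (((((F.P P.K).d + 2) * (F.P P.K).L : ℕ) : ℝ) ^ 2 / 4 * θ.toStage13Params.ν.ε₀) < ((((F.P P.K).L : ℝ)) ^ ((F.P P.K).d - 1))⁻¹)
    (hord' : 2 * θ.toStage13Params.ν.εreg / ((F.P P.K).L : ℝ) ^ 2 +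
      4 * max θ.toStage13Params.ε₂₉ (10 * (((((F.P P.K).d + 2) * (F.P P.K).L : ℕ) : ℝ) * θ.toStage13Params.ε₂₉) * ((F.P P.K).L : ℝ) ^ ((F.P P.K).d - 1)) <
        θ.toStage13Params.ν.ε₀)
    (hfed : ((((F.P P.K).d * (F.P P.K).L : ℕ) : ℝ)) ^ 2 / 4 * θ.toStage13Params.ν.ε₀ < deltaFed (Fin N))
    -- N07's LEVEL-WISE slots (DISPLAYED): [B11] Thm 1 at OBJECTS and the ₈a rows at every member `(P.K, k)`, the level-wise `h11`
    (hT1 : ∀ k, k ≤ P.K → ∀ ε₁ : ℝ, 0 < ε₁ → ε₁ ≤ a₁ → ∀ V : GaugeField (F.P P.K) k (SU N), PlaqSmall ε₁ V →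
      (∃ U : GaugeField (F.P P.K) 0 (SU N), IsBackground (avOfRecord F N P.K) {U | InUkClassB11 F N P.K k (B₃ * ε₁) U} k V U) ∧
      (∀ ε₀ : ℝ, B₃ * ε₁ ≤ ε₀ → ε₀ ≤ a₀ → ∀ U U' : GaugeField (F.P P.K) 0 (SU N),
          IsBackground (avOfRecord F N P.K) {U | InUkClassB11 F N P.K k (B₃ * ε₁) U} k V U →
          IsBackground (avOfRecord F N P.K) {U | InUkClassB11 F N P.K k ε₀ U} k V U' → InUkClassB11 F N P.K k ε₀ U ∧ OrbitRel k U U'))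
    (hUk : ∀ k, k ≤ P.K → ∀ (V : GaugeField (F.P P.K) k (SU N)) (δ : ℝ), 0 < δ → δ ≤ a₁ → B₃ * δ ≤ θ.εbg → PlaqSmall δ V →
      UkExists F N P.K k θ.εbg V ∧ InUkClassB11 F N P.K k θ.εbg (Uk F N P.K k θ.εbg V))
    (h11 : ∀ k, k ≤ P.K → ∀ V ∈ domAltOfRecord F N θ.ν P.K k, UkExists F N P.K k θ.εbg V ∧ UniqueUkOrbit F N P.K k θ.εbg V)
    -- the object-slot road's letters (DISPLAYED)
    (hB₃ : 1 ≤ B₃) (hε₀ : 0 < θ.toStage13Params.ν.ε₀) (hε₀a : θ.toStage13Params.ν.ε₀ ≤ a₁)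
    (hq3 : (143 * (((((F.P P.K).d + 4 : ℕ) : ℝ)) ^ 2 / 4) ^ 2) * (B₃ * θ.toStage13Params.ν.ε₀) ≤ 1 / 3)
    (hq2 : 2 * (B₃ * θ.toStage13Params.ν.ε₀) ≤ 2 * deltaSU (Fin N) / ((((F.P P.K).d + 4) * (F.P P.K).L : ℕ) : ℝ) ^ 2)
    (hqa : 2 * (B₃ * θ.toStage13Params.ν.ε₀) ≤ a₁) (hB : 2 * B₃ * (B₃ * θ.toStage13Params.ν.ε₀) ≤ θ.εbg) (hhi : θ.εbg ≤ a₀) :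
    (leavesP w P).smallCouplings → (leavesP w P).smallFieldInductive :=
  thm3Member_stage13SepCoPH_atDomAlt_of_localRoute_of_hU_of_numerics_of_εreg_eq_alphaFree θ h P hC hε heq hεreg hε3 hε2 hn1 hn2 hcov hU hcrit h24 h64 hL hord' hε₀.le hfed h11
    (hres_of_thm1Objects_of_ukRows_of_domainThreshold θ.toStage13Params.ν θ.εbg a₀ a₁ B₃ P.K hT1 hUk (fun k hk V hV => (h11 k hk V hV).1) hB₃ hε₀ hε₀a hq3 hq2 hqa hB hhi)

end Door

end Summit.QuantumFields.YangMills.BalabanUVNodes.N09RecordDoorOfLocalRouteOfThm1Objects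

end
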